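import Literature.Analysis.FluidPDE.PassiveVectorTensorFourier
import Literature.Analysis.FluidPDE.PassiveVectorUniqueness
import Literature.Analysis.FluidPDE.CoupledModeEnergyBound
import HarnessLib

/-!
# Uniqueness of weak passive-vector solutions with a constant COERCIVE viscosity tensor and
# bounded carrier (tensor twin of `PassiveVectorUniqueness`)

Analysis/FluidPDE proof-support file (everything proved; no new definitions). For the weak class
`Torus.IsWeakTensorPassiveVectorOn A T 𝔸 b w₀ w` (`∂ₜw + (b·∇)w + A (w·∇)b + ∇π = 𝓛_𝔸 w`,
`∇·w = 0`, `w ∈ L^∞_t L²_x`, tested against smooth divergence-free fields; `𝓛_𝔸` Frisch's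
anisotropic eddy viscosity (9.57)) with a constant tensor in a Legendre–Hadamard window
`NearIso 𝔸 lo hi`, `0 < lo` (NO symmetry of `𝔸` assumed), and a carrier `b ∈ L^∞((0,T) × T^d)`, we
prove, for EVERY coupling constant `A`:

* `lo_mul_le_re_inner_symbT` — coercivity of the symbol matrix on transversal vectors:
  `k · z = 0 ⇒ lo |k|² ‖z‖² ≤ Re ⟪z, T_𝔸(k) z⟫` (`Re ⟪z, T_𝔸(k) z⟫ = σ_𝔸(k, Re z) + σ_𝔸(k, Im z)`,
  `re_inner_symbT_eq` — the odd part of `𝔸` is invisible);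
* `IsWeakTensorPassiveVectorOn.ae_sq_norm_mFourierCoeff_le` — the uniform-in-`k` modewise energy
  bound for datum `0`: `‖ŵ(t)(k)‖² ≤ (d(1+A²)/(2 lo)) ∫_{(0,t]} ∑ⱼ (‖𝓕(bⱼw)(τ)(k)‖² + ‖𝓕(wⱼb)(τ)(k)‖²) dτ`
  for a.e. `t`.  Unlike the scalar case the `d − 1` tested mode equations of one wave vector are
  COUPLED through `T_𝔸(k)` (which need not preserve `k^⊥` nor be normal), so instead of the
  decoupled one-mode lemma we expand `ŵ(t)(k)` in an orthonormal basis of `k^⊥ ⊂ ℂ^d`, write the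
  tested identities of `PassiveVectorTensorFourier.ae_inner_mFourierCoeff_eq` as a coupled system
  with the matrix `Mᵢᵢ' = 4π² ⟪eᵢ', T_𝔸(k) eᵢ⟫`, coercive with constant `4π² lo |k|²` by the
  previous bullet, and apply the coupled-family energy bound
  `CoupledModeEnergyBound.sum_sq_norm_le_of_ae_eq_setIntegral` (Evans §7.1.2 Thm. 2, Step 1);
* `IsWeakTensorPassiveVectorOn.ae_eq_zero_of_memLp_top` — a solution with datum `0` vanishes a.e.
  (Plancherel, Tonelli, Grönwall a.e. in time — verbatim from the scalar file with the new constant);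
* `IsWeakTensorPassiveVectorOn.sub_of_eq`, `….ae_eq_of_memLp_top` — linearity and **uniqueness**:
  two solutions with the same datum and the same bounded carrier agree for a.e. `t ∈ (0,T)`.

Cell `ad-ideate`, tensor twin step (3a) (LIT-PACK §49 addendum 1(b): "the ONE lemma to re-prove is
the modewise bound … run the energy estimate on the VECTOR ŵ(k) … Result: the same statement with
ν ↦ lo"); consumers: the renormalised tensor chain of route `SolenoidalFractalHomogenisation`
(crux `LagrangianRenormalisationStep`, stubs `stub_baseT`, `stub_cellLawT` (V): "THE weak solution …
unique").

## Mathlib / tree search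

Tree: `PassiveVectorTensorFourier` (modewise identity, `symbT`), `PassiveVectorTensorClass`,
`PassiveVectorUniqueness` (scalar twin; `tsum_enorm_sq_mFourierCoeff_le_of_norm_le` reused),
`CoupledModeEnergyBound`, `TorusVectorParseval`, `TorusTrigPoly`
(`IsWeaklyDivFree.sum_mul_mFourierCoeff_eq_zero`), `PerturbedEnergyGronwall.ae_gronwall_const`.
Mathlib: `stdOrthonormalBasis`, `OrthonormalBasis.sum_repr'`, `OrthonormalBasis.repr_apply_apply`,
`Submodule.mem_orthogonal_singleton_iff_inner_right`, `Submodule.finrank_le`,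
`finrank_euclideanSpace`, `EuclideanSpace.inner_single_right`.

## References

* U. Frisch, *Turbulence* (CUP 1995), §9.6.3 eq. (9.57) p. 233. [`Frisch1995Turbulence`]
* M. Giaquinta, *Multiple integrals in the calculus of variations and nonlinear elliptic systems*
  (Princeton 1983), Ch. III §2 (2.2) (Legendre–Hadamard condition). [`Giaquinta1983MultipleIntegrals`]
* L. C. Evans, *Partial Differential Equations*, 2nd ed. (AMS 2010), §7.1.2 Thm. 2. [`Evans2010`]
* P. Bonicatto, G. Ciampa, G. Crippa, J. Math. Pures Appl. 183 (2024), Cor. 3.5. [`BonicattoCiampaCrippa2023`]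
* L. Grafakos, *Classical Fourier Analysis*, 3rd ed., GTM 249 (2014), Prop. 3.2.7. [`Grafakos2014`]
* R. J. DiPerna, P.-L. Lions, Invent. Math. 98 (1989), §II.1. [`DiPernaLions1989`]
-/

noncomputable section

open MeasureTheory Set Filter Function TopologicalSpace Complex UnitAddTorus
open scoped ENNReal NNReal InnerProductSpace ComplexConjugate

namespace Literature.Analysis.FluidPDE

namespace Torus

variable {d : Type*} [Fintype d]

/-! ## Arithmetic of the modewise right-hand side -/

section ModeArithmetic

/-- `(a + |A| b)² ≤ (1 + A²)(a² + b²)`. [folklore] -/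
private theorem sq_add_abs_mul_le' (A a b : ℝ) : (a + |A| * b) ^ 2 ≤ (1 + A ^ 2) * (a ^ 2 + b ^ 2) := by
  nlinarith [sq_nonneg (|A| * a - b), sq_abs A]

/-- **The transport and stretching terms of one tested mode equation** (Cauchy–Schwarz):
`‖∑ⱼ 2πi kⱼ ⟪Fⱼ, z⟫ + A ∑ⱼ 2πi kⱼ ⟪Gⱼ, z⟫‖² ≤ 4π²|k|² (‖z‖²(1 + A²) ∑ⱼ (‖Fⱼ‖² + ‖Gⱼ‖²))`. [folklore] -/
private theorem norm_sq_modeRHS_le' (A : ℝ) (k : d → ℤ) (z : EuclideanSpace ℂ d)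
    (F G : d → EuclideanSpace ℂ d) :
    ‖(∑ j, (2 * Real.pi * I * (k j)) * ⟪F j, z⟫_ℂ) + (A : ℂ) * ∑ j, (2 * Real.pi * I * (k j)) * ⟪G j, z⟫_ℂ‖ ^ 2 ≤
      (4 * Real.pi ^ 2 * FunctionSpaces.Torus.freqNormSq k) *
        (‖z‖ ^ 2 * (1 + A ^ 2) * ∑ j, (‖F j‖ ^ 2 + ‖G j‖ ^ 2)) := by
  have hkj : ∀ j, ‖(2 * Real.pi * I * (k j) : ℂ)‖ = 2 * Real.pi * |(k j : ℝ)| := by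
    intro j
    rw [norm_mul, norm_mul, norm_mul, Complex.norm_I, mul_one, Complex.norm_intCast, Complex.norm_real,
      Real.norm_eq_abs, abs_of_pos Real.pi_pos, ← Int.cast_abs, Int.cast_abs]
    norm_num
  have h1 : ‖(∑ j, (2 * Real.pi * I * (k j)) * ⟪F j, z⟫_ℂ) + (A : ℂ) * ∑ j, (2 * Real.pi * I * (k j)) * ⟪G j, z⟫_ℂ‖ ≤
      ∑ j, (2 * Real.pi * |(k j : ℝ)|) * (‖z‖ * (‖F j‖ + |A| * ‖G j‖)) := by
    rw [Finset.mul_sum, ← Finset.sum_add_distrib]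
    refine (norm_sum_le _ _).trans (Finset.sum_le_sum fun j _ => ?_)
    have a1 : ‖(2 * Real.pi * I * (k j)) * ⟪F j, z⟫_ℂ‖ ≤ 2 * Real.pi * |(k j : ℝ)| * (‖F j‖ * ‖z‖) := by
      rw [norm_mul, hkj]
      exact mul_le_mul_of_nonneg_left (norm_inner_le_norm _ _) (by positivity)
    have a2 : ‖(A : ℂ) * ((2 * Real.pi * I * (k j)) * ⟪G j, z⟫_ℂ)‖ ≤
        |A| * (2 * Real.pi * |(k j : ℝ)| * (‖G j‖ * ‖z‖)) := by
      rw [norm_mul, norm_mul, hkj, Complex.norm_real, Real.norm_eq_abs]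
      exact mul_le_mul_of_nonneg_left (mul_le_mul_of_nonneg_left (norm_inner_le_norm _ _) (by positivity))
        (abs_nonneg _)
    calc ‖(2 * Real.pi * I * (k j)) * ⟪F j, z⟫_ℂ + (A : ℂ) * ((2 * Real.pi * I * (k j)) * ⟪G j, z⟫_ℂ)‖
        ≤ ‖(2 * Real.pi * I * (k j)) * ⟪F j, z⟫_ℂ‖ + ‖(A : ℂ) * ((2 * Real.pi * I * (k j)) * ⟪G j, z⟫_ℂ)‖ :=
          norm_add_le _ _
      _ ≤ 2 * Real.pi * |(k j : ℝ)| * (‖F j‖ * ‖z‖) + |A| * (2 * Real.pi * |(k j : ℝ)| * (‖G j‖ * ‖z‖)) :=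
          add_le_add a1 a2
      _ = 2 * Real.pi * |(k j : ℝ)| * (‖z‖ * (‖F j‖ + |A| * ‖G j‖)) := by ring
  have h2 : (∑ j, (2 * Real.pi * |(k j : ℝ)|) * (‖z‖ * (‖F j‖ + |A| * ‖G j‖))) ^ 2 ≤
      (∑ j, (2 * Real.pi * |(k j : ℝ)|) ^ 2) * ∑ j, (‖z‖ * (‖F j‖ + |A| * ‖G j‖)) ^ 2 :=
    Finset.sum_mul_sq_le_sq_mul_sq _ _ _
  have h3 : ∑ j, (2 * Real.pi * |(k j : ℝ)|) ^ 2 = 4 * Real.pi ^ 2 * FunctionSpaces.Torus.freqNormSq k := by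
    rw [FunctionSpaces.Torus.freqNormSq, Finset.mul_sum]
    exact Finset.sum_congr rfl fun j _ => by rw [mul_pow, sq_abs]; ring
  have h4 : ∑ j, (‖z‖ * (‖F j‖ + |A| * ‖G j‖)) ^ 2 ≤ ‖z‖ ^ 2 * (1 + A ^ 2) * ∑ j, (‖F j‖ ^ 2 + ‖G j‖ ^ 2) := by
    rw [Finset.mul_sum]
    refine Finset.sum_le_sum fun j _ => ?_
    rw [mul_pow, mul_assoc]
    exact mul_le_mul_of_nonneg_left (sq_add_abs_mul_le' A _ _) (sq_nonneg _)
  calc ‖(∑ j, (2 * Real.pi * I * (k j)) * ⟪F j, z⟫_ℂ) + (A : ℂ) * ∑ j, (2 * Real.pi * I * (k j)) * ⟪G j, z⟫_ℂ‖ ^ 2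
      ≤ (∑ j, (2 * Real.pi * |(k j : ℝ)|) * (‖z‖ * (‖F j‖ + |A| * ‖G j‖))) ^ 2 :=
        pow_le_pow_left₀ (norm_nonneg _) h1 2
    _ ≤ (∑ j, (2 * Real.pi * |(k j : ℝ)|) ^ 2) * ∑ j, (‖z‖ * (‖F j‖ + |A| * ‖G j‖)) ^ 2 := h2
    _ ≤ (4 * Real.pi ^ 2 * FunctionSpaces.Torus.freqNormSq k) * (‖z‖ ^ 2 * (1 + A ^ 2) * ∑ j, (‖F j‖ ^ 2 + ‖G j‖ ^ 2)) := by
        rw [h3]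
        have hN0 := FunctionSpaces.Torus.freqNormSq_nonneg k
        exact mul_le_mul_of_nonneg_left h4 (by positivity)

end ModeArithmetic

/-! ## Coercivity of the symbol matrix on transversal vectors -/

section Coercive

/-- `Re((r v) ū) = r (Re u Re v + Im u Im v)` for real `r`. [folklore] -/
private theorem re_ofReal_mul_mul_conj (r : ℝ) (u v : ℂ) :
    ((r : ℂ) * v * conj u).re = r * (u.re * v.re + u.im * v.im) := by
  simp [Complex.mul_re, Complex.mul_im]
  ring

/-- **The real part of `⟪z, T_𝔸(k) z⟫` is the transverse symbol on the real and imaginary parts**: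
`Re ⟪z, T_𝔸(k) z⟫_ℂ = σ_𝔸(k, Re z) + σ_𝔸(k, Im z)` — valid for EVERY real tensor, symmetric or not
(the antisymmetric part of the block `M_𝔸(k)` contributes `i(Im·Re − Re·Im)`, purely imaginary).
[cite: Frisch1995Turbulence, §9.6.3 eq. (9.57) p. 233] -/
theorem re_inner_symbT_eq (𝔸 : Visc4 d) (k : d → ℤ) (z : EuclideanSpace ℂ d) :
    (⟪z, symbT 𝔸 k z⟫_ℂ).re =
      symb 𝔸 (fun a => (k a : ℝ)) (fun i => (z i).re) + symb 𝔸 (fun a => (k a : ℝ)) (fun i => (z i).im) := by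
  have h1 : (⟪z, symbT 𝔸 k z⟫_ℂ).re =
      ∑ j, ∑ i, ∑ a, ∑ b, (𝔸 i a j b * (k a : ℝ) * (k b : ℝ)) * ((z j).re * (z i).re + (z j).im * (z i).im) := by
    rw [PiLp.inner_apply, Complex.re_sum]
    refine Finset.sum_congr rfl fun j _ => ?_
    rw [RCLike.inner_apply, symbT_apply, Finset.sum_mul, Complex.re_sum]
    refine Finset.sum_congr rfl fun i _ => ?_
    rw [Finset.sum_mul, Complex.re_sum]
    refine Finset.sum_congr rfl fun a _ => ?_
    rw [Finset.sum_mul, Complex.re_sum]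
    refine Finset.sum_congr rfl fun b _ => ?_
    exact re_ofReal_mul_mul_conj _ _ _
  rw [h1, Finset.sum_comm]
  simp only [symb, ← Finset.sum_add_distrib]
  refine Finset.sum_congr rfl fun i _ => ?_
  rw [Finset.sum_comm]
  refine Finset.sum_congr rfl fun a _ => Finset.sum_congr rfl fun j _ =>
    Finset.sum_congr rfl fun b _ => ?_
  ring

/-- Transversality of a complex vector passes to its real and imaginary parts. [folklore] -/
private theorem sum_re_mul_eq_zero_of_transversal {k : d → ℤ} {z : EuclideanSpace ℂ d}
    (hz : ∑ j, (k j : ℂ) * z j = 0) :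
    ∑ i, (z i).re * (k i : ℝ) = 0 ∧ ∑ i, (z i).im * (k i : ℝ) = 0 := by
  have hre := congrArg Complex.re hz
  have him := congrArg Complex.im hz
  rw [Complex.re_sum, Complex.zero_re] at hre
  rw [Complex.im_sum, Complex.zero_im] at him
  constructor
  · rw [← hre]
    refine Finset.sum_congr rfl fun i _ => ?_
    rw [← Complex.ofReal_intCast, Complex.re_ofReal_mul, mul_comm]
  · rw [← him]
    refine Finset.sum_congr rfl fun i _ => ?_
    rw [← Complex.ofReal_intCast, Complex.im_ofReal_mul, mul_comm]

/-- **Coercivity of the symbol matrix on transversal vectors** (the Legendre–Hadamard lower window,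
complexified): `NearIso 𝔸 lo hi` and `k · z = 0` give `lo |k|² ‖z‖² ≤ Re ⟪z, T_𝔸(k) z⟫_ℂ`.
[cite: Giaquinta1983MultipleIntegrals, Ch. III §2 eq. (2.2)] -/
theorem lo_mul_le_re_inner_symbT {𝔸 : Visc4 d} {lo hi : ℝ} (h𝔸 : NearIso 𝔸 lo hi)
    {k : d → ℤ} {z : EuclideanSpace ℂ d} (hz : ∑ j, (k j : ℂ) * z j = 0) :
    lo * (FunctionSpaces.Torus.freqNormSq k * ‖z‖ ^ 2) ≤ (⟪z, symbT 𝔸 k z⟫_ℂ).re := by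
  obtain ⟨hre, him⟩ := sum_re_mul_eq_zero_of_transversal hz
  have h1 := (h𝔸 (fun a => (k a : ℝ)) (fun i => (z i).re) hre).1
  have h2 := (h𝔸 (fun a => (k a : ℝ)) (fun i => (z i).im) him).1
  have hnorm : ‖z‖ ^ 2 = ∑ i, (z i).re ^ 2 + ∑ i, (z i).im ^ 2 := by
    rw [EuclideanSpace.norm_sq_eq, ← Finset.sum_add_distrib]
    refine Finset.sum_congr rfl fun i _ => ?_
    rw [Complex.sq_norm, Complex.normSq_apply]
    ring
  rw [re_inner_symbT_eq, hnorm, FunctionSpaces.Torus.freqNormSq]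
  nlinarith [h1, h2]

end Coercive

/-! ## The transversal subspace `k^⊥ ⊂ ℂ^d` -/

section Transversal

/-- `⟪K, z⟫_ℂ = Σⱼ kⱼ zⱼ` for the integer wave vector `K = (kⱼ)`. [folklore] -/
private theorem inner_waveVec_left (k : d → ℤ) (z : EuclideanSpace ℂ d) :
    ⟪(WithLp.toLp 2 (fun j => ((k j : ℤ) : ℂ)) : EuclideanSpace ℂ d), z⟫_ℂ = ∑ j, (k j : ℂ) * z j := by
  rw [PiLp.inner_apply]
  refine Finset.sum_congr rfl fun j _ => ?_
  rw [RCLike.inner_apply]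
  show z j * conj (((k j : ℤ) : ℂ)) = _
  rw [map_intCast, mul_comm]

/-- Membership in the transversal subspace `(ℂ K)^⊥` is the divergence condition `k · z = 0`.
[cite: Temam1984, Ch. III §1.1] -/
theorem mem_orthogonal_waveVec_iff (k : d → ℤ) (z : EuclideanSpace ℂ d) :
    z ∈ (ℂ ∙ (WithLp.toLp 2 (fun j => ((k j : ℤ) : ℂ)) : EuclideanSpace ℂ d))ᗮ ↔
      ∑ j, (k j : ℂ) * z j = 0 := by
  rw [Submodule.mem_orthogonal_singleton_iff_inner_right, inner_waveVec_left]

/-- Parseval in a subspace: for `X ∈ S` and an orthonormal basis `(eᵢ)` of `S`,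
`Σᵢ |⟪X, eᵢ⟫|² = ‖X‖²`. [folklore] -/
private theorem sum_sq_norm_inner_onb {ι : Type*} [Fintype ι] {S : Submodule ℂ (EuclideanSpace ℂ d)}
    (b : OrthonormalBasis ι ℂ S) {X : EuclideanSpace ℂ d} (hX : X ∈ S) :
    ∑ i, ‖⟪X, (b i : EuclideanSpace ℂ d)⟫_ℂ‖ ^ 2 = ‖X‖ ^ 2 := by
  have h1 : ‖(⟨X, hX⟩ : S)‖ ^ 2 = ∑ i, ‖b.repr ⟨X, hX⟩ i‖ ^ 2 := by
    rw [← b.repr.norm_map, EuclideanSpace.norm_sq_eq]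
  have h2 : ∀ i, b.repr ⟨X, hX⟩ i = ⟪(b i : EuclideanSpace ℂ d), X⟫_ℂ := fun i => by
    rw [OrthonormalBasis.repr_apply_apply, Submodule.coe_inner]
  rw [show ‖X‖ = ‖(⟨X, hX⟩ : S)‖ from rfl, h1]
  refine Finset.sum_congr rfl fun i _ => ?_
  rw [h2, norm_inner_symm]

/-- Expansion in a subspace: `Σᵢ ⟪eᵢ, X⟫ eᵢ = X` for `X ∈ S`. [folklore] -/
private theorem sum_inner_smul_onb {ι : Type*} [Fintype ι] {S : Submodule ℂ (EuclideanSpace ℂ d)}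
    (b : OrthonormalBasis ι ℂ S) {X : EuclideanSpace ℂ d} (hX : X ∈ S) :
    ∑ i, ⟪(b i : EuclideanSpace ℂ d), X⟫_ℂ • (b i : EuclideanSpace ℂ d) = X := by
  have h := b.sum_repr' ⟨X, hX⟩
  have h' := congrArg (fun v : S => (v : EuclideanSpace ℂ d)) h
  simp only [Submodule.coe_sum, Submodule.coe_smul, Submodule.coe_inner] at h'
  exact h'

/-- The basis vectors of an orthonormal basis of a subspace have norm one in the ambient space.
[folklore] -/
private theorem norm_coe_onb {ι : Type*} [Fintype ι] {S : Submodule ℂ (EuclideanSpace ℂ d)}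
    (b : OrthonormalBasis ι ℂ S) (i : ι) : ‖(b i : EuclideanSpace ℂ d)‖ = 1 := by
  rw [Submodule.norm_coe]
  exact b.orthonormal.1 i

/-- `‖Σᵢ c̄ᵢ eᵢ‖² = Σᵢ |cᵢ|²` for an orthonormal basis of a subspace. [folklore] -/
private theorem norm_sq_sum_conj_smul_onb {ι : Type*} [Fintype ι] {S : Submodule ℂ (EuclideanSpace ℂ d)}
    (b : OrthonormalBasis ι ℂ S) (v : ι → ℂ) :
    ‖((∑ i, conj (v i) • b i : S) : EuclideanSpace ℂ d)‖ ^ 2 = ∑ i, ‖v i‖ ^ 2 := by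
  rw [Submodule.norm_coe]
  have h : (∑ i, conj (v i) • b i : S) = b.repr.symm (WithLp.toLp 2 fun i => conj (v i)) := by
    rw [← OrthonormalBasis.sum_repr_symm]
  rw [h, LinearIsometryEquiv.norm_map, EuclideanSpace.norm_sq_eq]
  refine Finset.sum_congr rfl fun i _ => ?_
  simp

end Transversal

/-! ## The modewise energy bound for a weak solution with datum `0` -/

section ModeBound

variable [DecidableEq d]

namespace IsWeakTensorPassiveVectorOn

variable {A T : ℝ} {𝔸 : Visc4 d} {b w : ℝ → UnitAddTorus d → EuclideanSpace ℝ d}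

omit [DecidableEq d] in
/-- An `L^∞` bound on the space–time lift is an a.e. bound on `(0,T) × T^d`. [folklore] -/
private theorem ae_norm_le_prod_of_memLp_top_stLift₃ {u : ℝ → UnitAddTorus d → EuclideanSpace ℝ d} {T : ℝ}
    (hu : MemLp (FunctionSpaces.Torus.stLift u) ∞ (volume.restrict (Ioo 0 T ×ˢ univ))) :
    ∃ M : ℝ, 0 ≤ M ∧ ∀ᵐ q ∂(((volume : Measure ℝ).restrict (Ioo 0 T)).prod (volume : Measure (UnitAddTorus d))),
      ‖u q.1 q.2‖ ≤ M := by
  set μ' : Measure (ℝ × EuclideanSpace ℝ d) := volume.restrict (Ioo 0 T ×ˢ univ) with hμ'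
  set M : ℝ := (eLpNorm (FunctionSpaces.Torus.stLift u) ∞ μ').toReal with hM
  have hfin : eLpNorm (FunctionSpaces.Torus.stLift u) ∞ μ' < (⊤ : ℝ≥0∞) := hu.eLpNorm_lt_top
  have hae' : ∀ᵐ p ∂μ', ‖FunctionSpaces.Torus.stLift u p‖ ≤ M := by
    filter_upwards [ae_le_eLpNormEssSup (f := FunctionSpaces.Torus.stLift u) (μ := μ')] with p hp
    rw [← eLpNorm_exponent_top] at hp
    have := ENNReal.toReal_mono hfin.ne hp
    rwa [toReal_enorm] at this
  refine ⟨M, ENNReal.toReal_nonneg, ?_⟩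
  have hprod : μ' = ((volume : Measure ℝ).restrict (Ioo 0 T)).prod volume := by
    rw [hμ', Measure.volume_eq_prod, ← Measure.prod_restrict, Measure.restrict_univ]
  rw [hprod] at hae'
  have hq := MeasureTheory.QuasiMeasurePreserving.prodMap
    (Measure.QuasiMeasurePreserving.id ((volume : Measure ℝ).restrict (Ioo 0 T)))
    (FunctionSpaces.Torus.quasiMeasurePreserving_repr (d := d))
  filter_upwards [hq.ae hae'] with q hq'
  simpa [FunctionSpaces.Torus.stLift] using hq'

omit [DecidableEq d] in
/-- The Fourier coefficients of the zero field vanish. [folklore] -/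
private theorem mFourierCoeff_complexify_zero₃ (k : d → ℤ) :
    mFourierCoeff (FunctionSpaces.EuclideanSpace.complexify ∘ (0 : UnitAddTorus d → EuclideanSpace ℝ d)) k = 0 := by
  rw [FunctionSpaces.Torus.mFourierCoeff_eq_integral_volume]
  simp

/-- Slice facts for a solution with a carrier bounded by `M` a.e. on `(0,T) × T^d`: for a.e. `τ`,
`w(τ) ∈ L²`, and the products `bⱼ(τ) w(τ)`, `wⱼ(τ) b(τ)` satisfy `∑ₖ ‖𝓕(·)(k)‖ₑ² ≤ M² ∫⁻ ‖w(τ)‖ₑ²`.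
[cite: Grafakos2014, Prop. 3.2.7 (3)] -/
theorem ae_tsum_enorm_sq_mFourierCoeff_products_le {w₀ : UnitAddTorus d → EuclideanSpace ℝ d}
    (h : IsWeakTensorPassiveVectorOn A T 𝔸 b w₀ w) {M : ℝ} (hM : 0 ≤ M)
    (hbM : ∀ᵐ q ∂(((volume : Measure ℝ).restrict (Ioo 0 T)).prod (volume : Measure (UnitAddTorus d))),
      ‖b q.1 q.2‖ ≤ M) :
    ∀ᵐ τ ∂(volume.restrict (Ioo 0 T)), MemLp (w τ) 2 volume ∧ ∀ j,
      (∑' k, ‖mFourierCoeff (FunctionSpaces.EuclideanSpace.complexify ∘ fun x => b τ x j • w τ x) k‖ₑ ^ 2 ≤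
          ENNReal.ofReal (M ^ 2) * ∫⁻ x, ‖w τ x‖ₑ ^ 2) ∧
        (∑' k, ‖mFourierCoeff (FunctionSpaces.EuclideanSpace.complexify ∘ fun x => w τ x j • b τ x) k‖ₑ ^ 2 ≤
          ENNReal.ofReal (M ^ 2) * ∫⁻ x, ‖w τ x‖ₑ ^ 2) := by
  filter_upwards [h.ae_memLp_two, h.ae_aestronglyMeasurable_slice, Measure.ae_ae_of_ae_prod hbM] with τ h1 h2 h3
  refine ⟨h1, fun j => ⟨?_, ?_⟩⟩
  · have hg : AEStronglyMeasurable (fun x => b τ x j • w τ x) volume :=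
      ((EuclideanSpace.proj j).continuous.comp_aestronglyMeasurable h2.2).smul h2.1
    refine (tsum_enorm_sq_mFourierCoeff_le_of_norm_le h1 hg hM ?_).2
    filter_upwards [h3] with x hx
    show ‖b τ x j • w τ x‖ ≤ M * ‖w τ x‖
    rw [norm_smul]
    refine mul_le_mul_of_nonneg_right ?_ (norm_nonneg _)
    exact (Real.norm_eq_abs _ ▸ FunctionSpaces.Torus.abs_apply_le_norm (b τ x) j).trans hx
  · have hg : AEStronglyMeasurable (fun x => w τ x j • b τ x) volume :=
      ((EuclideanSpace.proj j).continuous.comp_aestronglyMeasurable h2.1).smul h2.2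
    refine (tsum_enorm_sq_mFourierCoeff_le_of_norm_le h1 hg hM ?_).2
    filter_upwards [h3] with x hx
    show ‖w τ x j • b τ x‖ ≤ M * ‖w τ x‖
    rw [norm_smul, mul_comm]
    refine mul_le_mul ?_ ?_ (norm_nonneg _) hM
    · exact hx
    · exact Real.norm_eq_abs _ ▸ FunctionSpaces.Torus.abs_apply_le_norm (w τ x) j

/-- `k · ŵ(t)(k) = 0` for a.e. `t`: the Fourier coefficients of a weak solution are transversal.
[cite: Temam1984, Ch. III §1.1] -/
theorem ae_sum_mul_mFourierCoeff_eq_zero {w₀ : UnitAddTorus d → EuclideanSpace ℝ d}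
    (h : IsWeakTensorPassiveVectorOn A T 𝔸 b w₀ w) (k : d → ℤ) :
    ∀ᵐ t ∂(volume.restrict (Ioo 0 T)),
      ∑ j, (k j : ℂ) * mFourierCoeff (FunctionSpaces.EuclideanSpace.complexify ∘ w t) k j = 0 := by
  filter_upwards [h.ae_memLp_two, h.ae_isWeaklyDivFree] with t h1 h2
  exact h2.sum_mul_mFourierCoeff_eq_zero h1 k

/-- **Uniform-in-`k` modewise energy bound (tensor viscosity).** For a weak solution with datum `0`,
a tensor with `NearIso 𝔸 lo hi`, `0 < lo`, and a carrier bounded by `M` a.e. on `(0,T) × T^d`: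
for every `k` and a.e. `t ∈ (0,T)`,
`‖ŵ(t)(k)‖² ≤ (d (1 + A²)/(2 lo)) ∫_{(0,t]} ∑ⱼ (‖𝓕(bⱼ w)(τ)(k)‖² + ‖𝓕(wⱼ b)(τ)(k)‖²) dτ`.
For `k ≠ 0` expand `ŵ(t)(k) ∈ k^⊥` in an orthonormal basis `(eᵢ)` of `k^⊥`; the tested identities
(`ae_inner_mFourierCoeff_eq` with `z = eᵢ`) form a coupled system with matrix
`Mᵢᵢ' = 4π² ⟪eᵢ', T_𝔸(k) eᵢ⟫`, coercive with constant `4π² lo |k|²` (`lo_mul_le_re_inner_symbT`), and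
`CoupledModeEnergyBound.sum_sq_norm_le_of_ae_eq_setIntegral` gives the bound with
`D = dim(k^⊥)(1 + A²)/(2 lo) ≤ d(1 + A²)/(2 lo)`; for `k = 0` the identity gives `ŵ(t)(0) = 0`.
[cite: Evans2010, §7.1.2 Thm. 2] -/
theorem ae_sq_norm_mFourierCoeff_le (h : IsWeakTensorPassiveVectorOn A T 𝔸 b 0 w)
    {lo hi : ℝ} (h𝔸 : NearIso 𝔸 lo hi) (hlo : 0 < lo) {M : ℝ} (hM : 0 ≤ M)
    (hbM : ∀ᵐ q ∂(((volume : Measure ℝ).restrict (Ioo 0 T)).prod (volume : Measure (UnitAddTorus d))),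
      ‖b q.1 q.2‖ ≤ M) (k : d → ℤ) :
    ∀ᵐ t ∂(volume.restrict (Ioo 0 T)),
      ‖mFourierCoeff (FunctionSpaces.EuclideanSpace.complexify ∘ w t) k‖ ^ 2 ≤
        (Fintype.card d * (1 + A ^ 2) / (2 * lo)) * ∫ τ in Ioc 0 t, ∑ j,
          (‖mFourierCoeff (FunctionSpaces.EuclideanSpace.complexify ∘ fun x => b τ x j • w τ x) k‖ ^ 2 +
            ‖mFourierCoeff (FunctionSpaces.EuclideanSpace.complexify ∘ fun x => w τ x j • b τ x) k‖ ^ 2) := by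
  obtain ⟨C, hC⟩ := h.ae_lintegral_sq_le
  set N : ℝ := FunctionSpaces.Torus.freqNormSq k with hN
  set X : ℝ → EuclideanSpace ℂ d := fun t => mFourierCoeff (FunctionSpaces.EuclideanSpace.complexify ∘ w t) k
    with hX
  set F : d → ℝ → EuclideanSpace ℂ d := fun j τ =>
    mFourierCoeff (FunctionSpaces.EuclideanSpace.complexify ∘ fun x => b τ x j • w τ x) k with hF
  set G : d → ℝ → EuclideanSpace ℂ d := fun j τ =>
    mFourierCoeff (FunctionSpaces.EuclideanSpace.complexify ∘ fun x => w τ x j • b τ x) k with hG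
  set γ : ℝ → ℝ := fun τ => ∑ j, (‖F j τ‖ ^ 2 + ‖G j τ‖ ^ 2) with hγ
  have hN0 : 0 ≤ N := FunctionSpaces.Torus.freqNormSq_nonneg k
  have hXi : IntegrableOn X (Ioo 0 T) := h.integrableOn_mFourierCoeff k
  have hFi : ∀ j, IntegrableOn (F j) (Ioo 0 T) := fun j => h.integrableOn_mFourierCoeff_carrier_smul j k
  have hGi : ∀ j, IntegrableOn (G j) (Ioo 0 T) := fun j => h.integrableOn_mFourierCoeff_smul_carrier j k
  -- `‖F j τ‖², ‖G j τ‖² ≤ M² C` a.e., so `γ` is integrable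
  have hslice := h.ae_tsum_enorm_sq_mFourierCoeff_products_le hM hbM
  have hFG : ∀ j, ∀ᵐ τ ∂(volume.restrict (Ioo 0 T)), ‖F j τ‖ ^ 2 ≤ M ^ 2 * C ∧ ‖G j τ‖ ^ 2 ≤ M ^ 2 * C := by
    intro j
    filter_upwards [hslice, hC] with τ hτ hτC
    have conv : ∀ (Y : EuclideanSpace ℂ d), ‖Y‖ₑ ^ 2 ≤ ENNReal.ofReal (M ^ 2) * C → ‖Y‖ ^ 2 ≤ M ^ 2 * C := by
      intro Y hY
      have h2 : ‖Y‖ₑ ^ 2 = ENNReal.ofReal (‖Y‖ ^ 2) := by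
        rw [← ofReal_norm, ENNReal.ofReal_pow (norm_nonneg _)]
      rw [h2, ← ENNReal.ofReal_coe_nnreal, ← ENNReal.ofReal_mul (sq_nonneg _)] at hY
      exact (ENNReal.ofReal_le_ofReal_iff (by positivity)).1 hY
    exact ⟨conv _ (((ENNReal.le_tsum k).trans (hτ.2 j).1).trans (mul_le_mul_right hτC _)),
      conv _ (((ENNReal.le_tsum k).trans (hτ.2 j).2).trans (mul_le_mul_right hτC _))⟩
  have hγi : IntegrableOn γ (Ioo 0 T) := by
    have hm : AEStronglyMeasurable γ (volume.restrict (Ioo 0 T)) :=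
      Finset.aestronglyMeasurable_fun_sum _ fun j _ =>
        ((hFi j).aestronglyMeasurable.norm.pow 2).add ((hGi j).aestronglyMeasurable.norm.pow 2)
    refine IntegrableOn.of_bound measure_Ioo_lt_top hm (∑ _j : d, (M ^ 2 * C + M ^ 2 * C)) ?_
    have hall : ∀ᵐ τ ∂(volume.restrict (Ioo 0 T)), ∀ j, ‖F j τ‖ ^ 2 ≤ M ^ 2 * C ∧ ‖G j τ‖ ^ 2 ≤ M ^ 2 * C :=
      ae_all_iff.2 fun j => hFG j
    filter_upwards [hall] with τ hτ
    rw [Real.norm_eq_abs, abs_of_nonneg (Finset.sum_nonneg fun j _ => by positivity)]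
    exact Finset.sum_le_sum fun j _ => add_le_add (hτ j).1 (hτ j).2
  have hγ0 : ∀ᵐ τ ∂(volume.restrict (Ioo 0 T)), 0 ≤ γ τ :=
    ae_of_all _ fun τ => Finset.sum_nonneg fun j _ => by positivity
  have hI0 : ∀ t, 0 ≤ ∫ τ in Ioc 0 t, γ τ := fun t =>
    setIntegral_nonneg measurableSet_Ioc fun τ _ => Finset.sum_nonneg fun j _ => by positivity
  have hD0 : 0 ≤ Fintype.card d * (1 + A ^ 2) / (2 * lo) := by positivity
  have hdiv := h.ae_sum_mul_mFourierCoeff_eq_zero k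
  by_cases hk : k = 0
  · -- `k = 0`: the mode is constant in time, hence `= ŵ₀(0) = 0`
    subst hk
    have he : ∀ i, ∑ j, (((0 : d → ℤ) j : ℤ) : ℂ) * (EuclideanSpace.single i (1 : ℂ) : EuclideanSpace ℂ d) j = 0 := by
      intro i; simp
    have hall := ae_all_iff.2 fun i => h.ae_inner_mFourierCoeff_eq (integrable_zero _ _ _) 0 (he i)
    filter_upwards [hall] with t ht
    have hX0 : X t = 0 := by
      ext i
      have h1 := ht i
      rw [mFourierCoeff_complexify_zero₃, inner_zero_left, zero_add] at h1
      have hint : (fun τ => (-(4 * Real.pi ^ 2 : ℝ) : ℂ) *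
            ⟪mFourierCoeff (FunctionSpaces.EuclideanSpace.complexify ∘ w τ) 0,
              symbT 𝔸 0 (EuclideanSpace.single i (1 : ℂ))⟫_ℂ +
          ((∑ j, (2 * Real.pi * I * (((0 : d → ℤ) j : ℤ) : ℂ)) *
              ⟪mFourierCoeff (FunctionSpaces.EuclideanSpace.complexify ∘ fun x => b τ x j • w τ x) 0,
                EuclideanSpace.single i (1 : ℂ)⟫_ℂ) +
            (A : ℂ) * ∑ j, (2 * Real.pi * I * (((0 : d → ℤ) j : ℤ) : ℂ)) *
              ⟪mFourierCoeff (FunctionSpaces.EuclideanSpace.complexify ∘ fun x => w τ x j • b τ x) 0,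
                EuclideanSpace.single i (1 : ℂ)⟫_ℂ)) = fun _ => 0 := by
        funext τ
        simp
      rw [hint, integral_zero, EuclideanSpace.inner_single_right, one_mul, map_eq_zero] at h1
      rw [hX]
      simpa using h1
    rw [hX] at hX0
    simp only at hX0
    rw [hX0, norm_zero]
    simp only [ne_eq, OfNat.ofNat_ne_zero, not_false_eq_true, zero_pow]
    exact mul_nonneg hD0 (hI0 t)
  · -- `k ≠ 0`: coupled system in an orthonormal basis of `k^⊥`
    have hNpos : 0 < N := by
      rcases hN0.eq_or_lt with h0 | h0
      · exfalso
        apply hk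
        funext j
        have hsum0 : ∑ i, ((k i : ℤ) : ℝ) ^ 2 = 0 := by
          rw [hN, FunctionSpaces.Torus.freqNormSq] at h0
          exact h0.symm
        have hj : ((k j : ℤ) : ℝ) ^ 2 = 0 :=
          (Finset.sum_eq_zero_iff_of_nonneg fun i _ => sq_nonneg ((k i : ℤ) : ℝ)).1 hsum0 j (Finset.mem_univ j)
        have hj' : ((k j : ℤ) : ℝ) = 0 := (pow_eq_zero_iff two_ne_zero).1 hj
        exact_mod_cast hj'
      · exact h0
    set S : Submodule ℂ (EuclideanSpace ℂ d) :=
      (ℂ ∙ (WithLp.toLp 2 (fun j => ((k j : ℤ) : ℂ)) : EuclideanSpace ℂ d))ᗮ with hS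
    let bS := stdOrthonormalBasis ℂ S
    set e : Fin (Module.finrank ℂ S) → EuclideanSpace ℂ d := fun i => (bS i : EuclideanSpace ℂ d) with he
    have he_tr : ∀ i, ∑ j, (k j : ℂ) * e i j = 0 := fun i =>
      (mem_orthogonal_waveVec_iff k _).1 (bS i).2
    have he_norm : ∀ i, ‖e i‖ = 1 := fun i => norm_coe_onb bS i
    -- the coupled data
    set c : Fin (Module.finrank ℂ S) → ℝ → ℂ := fun i t => ⟪X t, e i⟫_ℂ with hc
    set β : Fin (Module.finrank ℂ S) → ℝ → ℂ := fun i τ =>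
      (∑ j, (2 * Real.pi * I * (k j)) * ⟪F j τ, e i⟫_ℂ) +
        (A : ℂ) * ∑ j, (2 * Real.pi * I * (k j)) * ⟪G j τ, e i⟫_ℂ with hβ
    set Mm : Fin (Module.finrank ℂ S) → Fin (Module.finrank ℂ S) → ℂ := fun i i' =>
      ((4 * Real.pi ^ 2 : ℝ) : ℂ) * ⟪e i', symbT 𝔸 k (e i)⟫_ℂ with hMm
    set ν : ℝ := 4 * Real.pi ^ 2 * lo * N with hν
    set D : ℝ := Fintype.card (Fin (Module.finrank ℂ S)) * (1 + A ^ 2) / (2 * lo) with hD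
    have hν0 : 0 ≤ ν := by positivity
    have hD0' : 0 ≤ D := by positivity
    have hci : ∀ i, IntegrableOn (c i) (Ioo 0 T) := fun i => hXi.inner_const (e i)
    have hβi : ∀ i, IntegrableOn (β i) (Ioo 0 T) := fun i =>
      (integrable_finsetSum _ fun j _ => ((hFi j).inner_const (e i)).const_mul _).add
        ((integrable_finsetSum _ fun j _ => ((hGi j).inner_const (e i)).const_mul _).const_mul _)
    -- coercivity of `Mm`
    have hMcoer : ∀ v : Fin (Module.finrank ℂ S) → ℂ,
        ν * ∑ i, ‖v i‖ ^ 2 ≤ (∑ i, conj (v i) * ∑ i', Mm i i' * v i').re := by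
      intro v
      set YS : S := ∑ i, conj (v i) • bS i with hYS
      set Y : EuclideanSpace ℂ d := (YS : EuclideanSpace ℂ d) with hY
      have hYe : Y = ∑ i, conj (v i) • e i := by
        rw [hY, hYS, Submodule.coe_sum]
        rfl
      have hYtr : ∑ j, (k j : ℂ) * Y j = 0 := (mem_orthogonal_waveVec_iff k Y).1 YS.2
      have hYnorm : ‖Y‖ ^ 2 = ∑ i, ‖v i‖ ^ 2 := norm_sq_sum_conj_smul_onb bS v
      -- `Σᵢ v̄ᵢ Σᵢ' Mᵢᵢ' vᵢ' = 4π² ⟪Y, T Y⟫`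
      have hform : ∑ i, conj (v i) * ∑ i', Mm i i' * v i' = ((4 * Real.pi ^ 2 : ℝ) : ℂ) * ⟪Y, symbT 𝔸 k Y⟫_ℂ := by
        rw [hYe, symbT_sum, sum_inner, Finset.mul_sum]
        simp_rw [inner_sum, Finset.mul_sum]
        conv_lhs => rw [Finset.sum_comm]
        refine Finset.sum_congr rfl fun p _ => Finset.sum_congr rfl fun q _ => ?_
        rw [symbT_smul, inner_smul_left, inner_smul_right, Complex.conj_conj, hMm]
        ring
      have hcoer := lo_mul_le_re_inner_symbT h𝔸 hYtr
      rw [hform, Complex.re_ofReal_mul, ← hYnorm, hν]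
      nlinarith [hcoer, Real.pi_pos]
    -- the coupled integral identities
    have heq : ∀ i, ∀ᵐ t ∂(volume.restrict (Ioo 0 T)),
        c i t = ∫ s in Ioc 0 t, (-(∑ i', Mm i i' * c i' s) + β i s) := by
      intro i
      have hexp : ∀ᵐ s ∂(volume.restrict (Ioo 0 T)),
          (-(4 * Real.pi ^ 2 : ℝ) : ℂ) * ⟪X s, symbT 𝔸 k (e i)⟫_ℂ = -(∑ i', Mm i i' * c i' s) := by
        filter_upwards [hdiv] with s hs
        have hXS : X s ∈ S := (mem_orthogonal_waveVec_iff k (X s)).2 hs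
        have hXe : X s = ∑ i', ⟪e i', X s⟫_ℂ • e i' := (sum_inner_smul_onb bS hXS).symm
        conv_lhs => rw [hXe]
        rw [sum_inner, Finset.mul_sum, ← Finset.sum_neg_distrib]
        refine Finset.sum_congr rfl fun i' _ => ?_
        rw [inner_smul_left, inner_conj_symm, hMm, hc]
        simp only
        push_cast
        ring
      filter_upwards [h.ae_inner_mFourierCoeff_eq (integrable_zero _ _ _) k (he_tr i),
        ae_restrict_mem measurableSet_Ioo] with t ht htT
      rw [hc]
      simp only
      rw [ht, mFourierCoeff_complexify_zero₃, inner_zero_left, zero_add]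
      refine setIntegral_congr_ae measurableSet_Ioc ?_
      have h1 : ∀ᵐ s ∂(volume : Measure ℝ), s ∈ Ioo 0 T →
          (-(4 * Real.pi ^ 2 : ℝ) : ℂ) * ⟪X s, symbT 𝔸 k (e i)⟫_ℂ = -(∑ i', Mm i i' * c i' s) :=
        (ae_restrict_iff' measurableSet_Ioo).1 hexp
      filter_upwards [h1] with s hs hst
      have hs' : s ∈ Ioo 0 T := ⟨hst.1, hst.2.trans_lt htT.2⟩
      rw [hs hs']
    -- the bound on `Σᵢ |βᵢ|²`
    have hbound : ∀ᵐ s ∂(volume.restrict (Ioo 0 T)), ∑ i, ‖β i s‖ ^ 2 ≤ 2 * ν * D * γ s := by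
      refine ae_of_all _ fun s => ?_
      have hper : ∀ i, ‖β i s‖ ^ 2 ≤ (4 * Real.pi ^ 2 * N) * ((1 + A ^ 2) * γ s) := by
        intro i
        have h1 := norm_sq_modeRHS_le' A k (e i) (fun j => F j s) (fun j => G j s)
        rw [he_norm i, one_pow, one_mul] at h1
        exact h1
      calc ∑ i, ‖β i s‖ ^ 2 ≤ ∑ _i : Fin (Module.finrank ℂ S), (4 * Real.pi ^ 2 * N) * ((1 + A ^ 2) * γ s) :=
            Finset.sum_le_sum fun i _ => hper i
        _ = Fintype.card (Fin (Module.finrank ℂ S)) * ((4 * Real.pi ^ 2 * N) * ((1 + A ^ 2) * γ s)) := by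
            rw [Finset.sum_const, Finset.card_univ, nsmul_eq_mul]
        _ = 2 * ν * D * γ s := by
            rw [hν, hD]
            field_simp
    -- the coupled-family energy bound
    have hfam := sum_sq_norm_le_of_ae_eq_setIntegral hν0 hD0' Mm hMcoer hci hβi hγi hγ0 heq hbound
    -- `Σᵢ |cᵢ(t)|² = ‖X t‖²` for a.e. `t`, and `D ≤ d(1+A²)/(2 lo)`
    have hcard : (Fintype.card (Fin (Module.finrank ℂ S)) : ℝ) ≤ Fintype.card d := by
      rw [Fintype.card_fin]
      have h1 : Module.finrank ℂ S ≤ Module.finrank ℂ (EuclideanSpace ℂ d) := Submodule.finrank_le S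
      rw [finrank_euclideanSpace] at h1
      exact_mod_cast h1
    have hDle : D ≤ Fintype.card d * (1 + A ^ 2) / (2 * lo) := by
      rw [hD]
      exact div_le_div_of_nonneg_right (mul_le_mul_of_nonneg_right hcard (by positivity)) (by positivity)
    filter_upwards [hfam, hdiv] with t ht htdiv
    have hXS : X t ∈ S := (mem_orthogonal_waveVec_iff k (X t)).2 htdiv
    have hPars : ∑ i, ‖c i t‖ ^ 2 = ‖X t‖ ^ 2 := sum_sq_norm_inner_onb bS hXS
    rw [hX] at hPars
    simp only at hPars
    rw [← hPars]
    exact ht.trans (mul_le_mul_of_nonneg_right hDle (hI0 t))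

/-- **A weak tensor-viscosity passive-vector solution with datum `0` and bounded carrier vanishes**
(`NearIso 𝔸 lo hi`, `0 < lo`, `b ∈ L^∞((0,T) × T^d)`, any `A`): `w(t) = 0` a.e. for a.e. `t ∈ (0,T)`.
Summing the modewise bounds over `k` (Parseval for vector fields, Tonelli) gives
`‖w(t)‖²_{L²} ≤ (d²M²(1+A²)/lo) ∫₀ᵗ ‖w‖²_{L²}` for a.e. `t`, and Grönwall a.e. in time
(`ae_gronwall_const`) concludes. [cite: Evans2010, §7.1.2 Thm. 2] -/
theorem ae_eq_zero_of_memLp_top (h : IsWeakTensorPassiveVectorOn A T 𝔸 b 0 w)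
    {lo hi : ℝ} (h𝔸 : NearIso 𝔸 lo hi) (hlo : 0 < lo)
    (hb : MemLp (FunctionSpaces.Torus.stLift b) ∞ (volume.restrict (Ioo 0 T ×ˢ univ))) :
    ∀ᵐ t ∂(volume.restrict (Ioo 0 T)), w t =ᵐ[volume] 0 := by
  obtain ⟨M, hM, hbM⟩ := ae_norm_le_prod_of_memLp_top_stLift₃ hb
  obtain ⟨C, hC⟩ := h.ae_lintegral_sq_le
  set D : ℝ := Fintype.card d * (1 + A ^ 2) / (2 * lo) with hD
  have hD0 : 0 ≤ D := by positivity
  set Φ : ℝ → ℝ≥0∞ := fun t => ∫⁻ x, ‖w t x‖ₑ ^ 2 with hΦ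
  set F : d → (d → ℤ) → ℝ → EuclideanSpace ℂ d := fun j k τ =>
    mFourierCoeff (FunctionSpaces.EuclideanSpace.complexify ∘ fun x => b τ x j • w τ x) k with hF
  set G : d → (d → ℤ) → ℝ → EuclideanSpace ℂ d := fun j k τ =>
    mFourierCoeff (FunctionSpaces.EuclideanSpace.complexify ∘ fun x => w τ x j • b τ x) k with hG
  have hFi : ∀ j k, IntegrableOn (F j k) (Ioo 0 T) := fun j k => h.integrableOn_mFourierCoeff_carrier_smul j k
  have hGi : ∀ j k, IntegrableOn (G j k) (Ioo 0 T) := fun j k => h.integrableOn_mFourierCoeff_smul_carrier j k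
  have hslice := h.ae_tsum_enorm_sq_mFourierCoeff_products_le hM hbM
  -- Plancherel bound for the fluxes: `∑ₖ γₖ(τ) ≤ 2 d M² Φ τ` a.e.
  have hflux : ∀ᵐ τ ∂(volume.restrict (Ioo 0 T)),
      ∑' k, ∑ j, (‖F j k τ‖ₑ ^ 2 + ‖G j k τ‖ₑ ^ 2) ≤ (Fintype.card d : ℝ≥0∞) * (2 * (ENNReal.ofReal (M ^ 2) * Φ τ)) := by
    filter_upwards [hslice] with τ hτ
    rw [Summable.tsum_finsetSum (fun _ _ => ENNReal.summable)]
    calc ∑ j, ∑' k, (‖F j k τ‖ₑ ^ 2 + ‖G j k τ‖ₑ ^ 2)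
        ≤ ∑ _j : d, 2 * (ENNReal.ofReal (M ^ 2) * Φ τ) := by
          refine Finset.sum_le_sum fun j _ => ?_
          rw [ENNReal.tsum_add, two_mul]
          exact add_le_add (hτ.2 j).1 (hτ.2 j).2
      _ = (Fintype.card d : ℝ≥0∞) * (2 * (ENNReal.ofReal (M ^ 2) * Φ τ)) := by
          rw [Finset.sum_const, Finset.card_univ, nsmul_eq_mul]
  -- all modewise bounds at once
  have hmodes : ∀ᵐ t ∂(volume.restrict (Ioo 0 T)), ∀ k : d → ℤ,
      ‖mFourierCoeff (FunctionSpaces.EuclideanSpace.complexify ∘ w t) k‖ ^ 2 ≤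
        D * ∫ τ in Ioc 0 t, ∑ j, (‖F j k τ‖ ^ 2 + ‖G j k τ‖ ^ 2) :=
    ae_all_iff.2 fun k => h.ae_sq_norm_mFourierCoeff_le h𝔸 hlo hM hbM k
  -- integrability of the `γₖ`
  have hγi : ∀ k, IntegrableOn (fun τ => ∑ j, (‖F j k τ‖ ^ 2 + ‖G j k τ‖ ^ 2)) (Ioo 0 T) := by
    intro k
    have hm : AEStronglyMeasurable (fun τ => ∑ j, (‖F j k τ‖ ^ 2 + ‖G j k τ‖ ^ 2)) (volume.restrict (Ioo 0 T)) :=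
      Finset.aestronglyMeasurable_fun_sum _ fun j _ =>
        ((hFi j k).aestronglyMeasurable.norm.pow 2).add ((hGi j k).aestronglyMeasurable.norm.pow 2)
    refine IntegrableOn.of_bound measure_Ioo_lt_top hm (∑ _j : d, (M ^ 2 * C + M ^ 2 * C)) ?_
    filter_upwards [hslice, hC] with τ hτ hτC
    rw [Real.norm_eq_abs, abs_of_nonneg (Finset.sum_nonneg fun j _ => by positivity)]
    refine Finset.sum_le_sum fun j _ => ?_
    have conv : ∀ (X : EuclideanSpace ℂ d), ‖X‖ₑ ^ 2 ≤ ENNReal.ofReal (M ^ 2) * C → ‖X‖ ^ 2 ≤ M ^ 2 * C := by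
      intro X hX
      have h2 : ‖X‖ₑ ^ 2 = ENNReal.ofReal (‖X‖ ^ 2) := by
        rw [← ofReal_norm, ENNReal.ofReal_pow (norm_nonneg _)]
      rw [h2, ← ENNReal.ofReal_coe_nnreal, ← ENNReal.ofReal_mul (sq_nonneg _)] at hX
      exact (ENNReal.ofReal_le_ofReal_iff (by positivity)).1 hX
    exact add_le_add (conv _ (((ENNReal.le_tsum k).trans (hτ.2 j).1).trans (mul_le_mul_right hτC _)))
      (conv _ (((ENNReal.le_tsum k).trans (hτ.2 j).2).trans (mul_le_mul_right hτC _)))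
  -- the integral inequality for `Φ`
  set L : ℝ≥0∞ := ENNReal.ofReal D * ((Fintype.card d : ℝ≥0∞) * (2 * ENNReal.ofReal (M ^ 2))) with hL
  have hLtop : L ≠ ⊤ := by
    rw [hL]
    exact ENNReal.mul_ne_top ENNReal.ofReal_ne_top
      (ENNReal.mul_ne_top (ENNReal.natCast_ne_top _) (ENNReal.mul_ne_top ENNReal.ofNat_ne_top ENNReal.ofReal_ne_top))
  have hΦ : ∀ᵐ t ∂(volume.restrict (Ioo 0 T)), Φ t ≤ 0 + L * ∫⁻ τ in Ioo 0 t, Φ τ := by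
    filter_upwards [hmodes, hslice, ae_restrict_mem measurableSet_Ioo] with t ht hts htT
    rw [zero_add]
    have hsub : Ioc 0 t ⊆ Ioo 0 T := fun τ hτ => ⟨hτ.1, hτ.2.trans_lt htT.2⟩
    rw [hΦ]
    simp only
    rw [← FunctionSpaces.Torus.tsum_enorm_sq_mFourierCoeff_complexify hts.1]
    have hk : ∀ k, ‖mFourierCoeff (FunctionSpaces.EuclideanSpace.complexify ∘ w t) k‖ₑ ^ 2 ≤
        ENNReal.ofReal D * ∫⁻ τ in Ioc 0 t, ∑ j, (‖F j k τ‖ₑ ^ 2 + ‖G j k τ‖ₑ ^ 2) := by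
      intro k
      have hγt : Integrable (fun τ => ∑ j, (‖F j k τ‖ ^ 2 + ‖G j k τ‖ ^ 2)) (volume.restrict (Ioc 0 t)) :=
        (hγi k).mono_set hsub
      have e1 : ‖mFourierCoeff (FunctionSpaces.EuclideanSpace.complexify ∘ w t) k‖ₑ ^ 2 =
          ENNReal.ofReal (‖mFourierCoeff (FunctionSpaces.EuclideanSpace.complexify ∘ w t) k‖ ^ 2) := by
        rw [← ofReal_norm, ENNReal.ofReal_pow (norm_nonneg _)]
      have e2 : ∫⁻ τ in Ioc 0 t, ∑ j, (‖F j k τ‖ₑ ^ 2 + ‖G j k τ‖ₑ ^ 2) =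
          ∫⁻ τ in Ioc 0 t, ENNReal.ofReal (∑ j, (‖F j k τ‖ ^ 2 + ‖G j k τ‖ ^ 2)) := by
        refine lintegral_congr fun τ => ?_
        rw [ENNReal.ofReal_sum_of_nonneg (fun j _ => by positivity)]
        refine Finset.sum_congr rfl fun j _ => ?_
        rw [ENNReal.ofReal_add (sq_nonneg _) (sq_nonneg _), ← ofReal_norm, ENNReal.ofReal_pow (norm_nonneg _),
          ← ofReal_norm, ENNReal.ofReal_pow (norm_nonneg _)]
      rw [e1, e2, ← ofReal_integral_eq_lintegral_ofReal hγt
          (ae_of_all _ fun τ => Finset.sum_nonneg fun j _ => by positivity), ← ENNReal.ofReal_mul hD0]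
      exact ENNReal.ofReal_le_ofReal (ht k)
    have hmeas : ∀ k, AEMeasurable (fun τ => ∑ j, (‖F j k τ‖ₑ ^ 2 + ‖G j k τ‖ₑ ^ 2)) (volume.restrict (Ioc 0 t)) := by
      intro k
      refine Finset.aemeasurable_fun_sum _ fun j _ => ?_
      exact (((hFi j k).aestronglyMeasurable.aemeasurable.mono_set hsub).enorm.pow_const 2).add
        (((hGi j k).aestronglyMeasurable.aemeasurable.mono_set hsub).enorm.pow_const 2)
    calc ∑' k, ‖mFourierCoeff (FunctionSpaces.EuclideanSpace.complexify ∘ w t) k‖ₑ ^ 2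
        ≤ ∑' k, ENNReal.ofReal D * ∫⁻ τ in Ioc 0 t, ∑ j, (‖F j k τ‖ₑ ^ 2 + ‖G j k τ‖ₑ ^ 2) :=
          ENNReal.tsum_le_tsum hk
      _ = ENNReal.ofReal D * ∫⁻ τ in Ioc 0 t, ∑' k, ∑ j, (‖F j k τ‖ₑ ^ 2 + ‖G j k τ‖ₑ ^ 2) := by
          rw [ENNReal.tsum_mul_left, lintegral_tsum hmeas]
      _ ≤ ENNReal.ofReal D * ∫⁻ τ in Ioc 0 t, (Fintype.card d : ℝ≥0∞) * (2 * (ENNReal.ofReal (M ^ 2) * Φ τ)) := by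
          gcongr 1
          exact lintegral_mono_ae (ae_restrict_of_ae_restrict_of_subset hsub hflux)
      _ = L * ∫⁻ τ in Ioo 0 t, Φ τ := by
          rw [lintegral_const_mul' _ _ (ENNReal.natCast_ne_top _),
            lintegral_const_mul' _ _ ENNReal.ofNat_ne_top,
            lintegral_const_mul' _ _ ENNReal.ofReal_ne_top,
            setLIntegral_congr (Ioo_ae_eq_Ioc (μ := (volume : Measure ℝ))), hL]
          ring
  have hΦC : ∀ᵐ t ∂(volume.restrict (Ioo 0 T)), Φ t ≤ (C : ℝ≥0∞) := hC
  have hGr := ae_gronwall_const (S := T) (φ := Φ) (B := 0) (M := C) (L := L) (by simp) ENNReal.coe_ne_top hLtop hΦC hΦ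
  filter_upwards [hGr, h.aestronglyMeasurable_uncurry.prodMk_left] with t ht hm
  have h0 : Φ t = 0 := le_antisymm (by simpa using ht) bot_le
  have hae : ∀ᵐ x ∂volume, ‖w t x‖ₑ ^ 2 = 0 :=
    (lintegral_eq_zero_iff' (hm.enorm.pow_const 2)).1 h0
  filter_upwards [hae] with x hx
  have hx' : ‖w t x‖ₑ = 0 := by simpa using hx
  simpa [enorm_eq_zero] using hx'

end IsWeakTensorPassiveVectorOn

end ModeBound

/-! ## Uniqueness -/

section Uniqueness

variable [DecidableEq d]

namespace IsWeakTensorPassiveVectorOn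

variable {A T : ℝ} {𝔸 : Visc4 d} {b w₁ w₂ : ℝ → UnitAddTorus d → EuclideanSpace ℝ d}
  {w₀ : UnitAddTorus d → EuclideanSpace ℝ d}

omit [DecidableEq d] in
/-- Differences of integrable weakly divergence-free fields are weakly divergence free. [folklore] -/
private theorem isWeaklyDivFree_sub₃ {u₁ u₂ : UnitAddTorus d → EuclideanSpace ℝ d}
    (h₁ : FunctionSpaces.Torus.IsWeaklyDivFree u₁) (h₂ : FunctionSpaces.Torus.IsWeaklyDivFree u₂)
    (hu₁ : Integrable u₁ volume) (hu₂ : Integrable u₂ volume) :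
    FunctionSpaces.Torus.IsWeaklyDivFree (fun x => u₁ x - u₂ x) := by
  intro θ hθ
  simp_rw [inner_sub_left]
  rw [integral_sub (FunctionSpaces.Torus.integrable_inner_of_continuous hu₁ hθ.gradient.continuous)
    (FunctionSpaces.Torus.integrable_inner_of_continuous hu₂ hθ.gradient.continuous), h₁ θ hθ, h₂ θ hθ, sub_zero]

/-- `‖b‖ ‖w₁ - w₂‖ ∈ L¹((0,T) × T^d)`. [cite: DiPernaLions1989, §II.1] -/
theorem lintegral_mul_sub_lt_top (h₁ : IsWeakTensorPassiveVectorOn A T 𝔸 b w₀ w₁)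
    (h₂ : IsWeakTensorPassiveVectorOn A T 𝔸 b w₀ w₂) :
    ∫⁻ t in Ioo 0 T, ∫⁻ x, ‖b t x‖ₑ * ‖w₁ t x - w₂ t x‖ₑ < ⊤ := by
  set μT : Measure ℝ := (volume : Measure ℝ).restrict (Ioo 0 T) with hμT
  have hmu := h₁.aestronglyMeasurable_uncurry_carrier
  have hm₁ := h₁.aestronglyMeasurable_uncurry
  have hm₂ := h₂.aestronglyMeasurable_uncurry
  have hF : AEMeasurable (fun p : ℝ × UnitAddTorus d => ‖b p.1 p.2‖ₑ * ‖w₁ p.1 p.2 - w₂ p.1 p.2‖ₑ)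
      (μT.prod volume) := hmu.enorm.mul (hm₁.sub hm₂).enorm
  have hF₁ : AEMeasurable (fun p : ℝ × UnitAddTorus d => ‖b p.1 p.2‖ₑ * ‖w₁ p.1 p.2‖ₑ) (μT.prod volume) :=
    hmu.enorm.mul hm₁.enorm
  have hF₂ : AEMeasurable (fun p : ℝ × UnitAddTorus d => ‖b p.1 p.2‖ₑ * ‖w₂ p.1 p.2‖ₑ) (μT.prod volume) :=
    hmu.enorm.mul hm₂.enorm
  have e : ∫⁻ t in Ioo 0 T, ∫⁻ x, ‖b t x‖ₑ * ‖w₁ t x - w₂ t x‖ₑ =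
      ∫⁻ p, ‖b p.1 p.2‖ₑ * ‖w₁ p.1 p.2 - w₂ p.1 p.2‖ₑ ∂(μT.prod volume) := (lintegral_prod _ hF).symm
  rw [e]
  calc ∫⁻ p, ‖b p.1 p.2‖ₑ * ‖w₁ p.1 p.2 - w₂ p.1 p.2‖ₑ ∂(μT.prod volume)
      ≤ ∫⁻ p, (‖b p.1 p.2‖ₑ * ‖w₁ p.1 p.2‖ₑ + ‖b p.1 p.2‖ₑ * ‖w₂ p.1 p.2‖ₑ) ∂(μT.prod volume) := by
        refine lintegral_mono fun p => ?_
        rw [← mul_add]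
        gcongr
        exact enorm_sub_le
    _ = (∫⁻ p, ‖b p.1 p.2‖ₑ * ‖w₁ p.1 p.2‖ₑ ∂(μT.prod volume)) +
          ∫⁻ p, ‖b p.1 p.2‖ₑ * ‖w₂ p.1 p.2‖ₑ ∂(μT.prod volume) := lintegral_add_left' hF₁ _
    _ = (∫⁻ t in Ioo 0 T, ∫⁻ x, ‖b t x‖ₑ * ‖w₁ t x‖ₑ) + ∫⁻ t in Ioo 0 T, ∫⁻ x, ‖b t x‖ₑ * ‖w₂ t x‖ₑ := by
        rw [lintegral_prod _ hF₁, lintegral_prod _ hF₂]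
    _ < ⊤ := ENNReal.add_lt_top.2 ⟨h₁.lintegral_mul_lt_top, h₂.lintegral_mul_lt_top⟩

/-- `‖f‖₂² = ∫⁻ ‖f‖ₑ²` in `ℝ≥0∞`. [folklore] -/
private theorem eLpNorm_two_pow_two₃ {α : Type*} [MeasurableSpace α] {μ : Measure α}
    {E : Type*} [NormedAddCommGroup E] (f : α → E) :
    eLpNorm f 2 μ ^ 2 = ∫⁻ x, ‖f x‖ₑ ^ 2 ∂μ := by
  rw [eLpNorm_eq_lintegral_rpow_enorm_toReal two_ne_zero ENNReal.ofNat_ne_top, ENNReal.toReal_ofNat,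
    ← ENNReal.rpow_natCast, ← ENNReal.rpow_mul]
  norm_num

/-- `w₁ - w₂ ∈ L^∞(0,T; L²)`. [cite: DiPernaLions1989, §II.1] -/
theorem ae_lintegral_sq_sub_le (h₁ : IsWeakTensorPassiveVectorOn A T 𝔸 b w₀ w₁)
    (h₂ : IsWeakTensorPassiveVectorOn A T 𝔸 b w₀ w₂) :
    ∃ C : ℝ≥0, ∀ᵐ t ∂(volume.restrict (Ioo 0 T)), ∫⁻ x, ‖w₁ t x - w₂ t x‖ₑ ^ 2 ≤ C := by
  obtain ⟨C₁, hC₁⟩ := h₁.exists_eLpNorm_le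
  obtain ⟨C₂, hC₂⟩ := h₂.exists_eLpNorm_le
  refine ⟨(C₁ + C₂) ^ 2, ?_⟩
  filter_upwards [hC₁, hC₂, h₁.ae_memLp_two, h₂.ae_memLp_two] with t hc₁ hc₂ hm₁ hm₂
  have hsub : eLpNorm (w₁ t - w₂ t) 2 volume ≤ C₁ + C₂ :=
    (eLpNorm_sub_le hm₁.1 hm₂.1 one_le_two).trans (add_le_add hc₁ hc₂)
  have e : ∫⁻ x, ‖w₁ t x - w₂ t x‖ₑ ^ 2 = eLpNorm (w₁ t - w₂ t) 2 volume ^ 2 := by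
    rw [eLpNorm_two_pow_two₃]
    rfl
  rw [e, ENNReal.coe_pow, ENNReal.coe_add]
  exact pow_le_pow_left' hsub 2

/-- **Linearity of the weak tensor-viscosity class**: the difference of two weak solutions with the
same carrier, coupling `A`, tensor and datum is a weak solution with datum `0`.
[cite: DiPernaLions1989, §II.1] -/
theorem sub_of_eq (h₁ : IsWeakTensorPassiveVectorOn A T 𝔸 b w₀ w₁)
    (h₂ : IsWeakTensorPassiveVectorOn A T 𝔸 b w₀ w₂) :
    IsWeakTensorPassiveVectorOn A T 𝔸 b 0 (fun t x => w₁ t x - w₂ t x) where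
  aestronglyMeasurable := h₁.aestronglyMeasurable.sub h₂.aestronglyMeasurable
  aestronglyMeasurable_carrier := h₁.aestronglyMeasurable_carrier
  ae_lintegral_sq_le := ae_lintegral_sq_sub_le h₁ h₂
  lintegral_carrier_lt_top := h₁.lintegral_carrier_lt_top
  lintegral_mul_lt_top := lintegral_mul_sub_lt_top h₁ h₂
  ae_isWeaklyDivFree_carrier := h₁.ae_isWeaklyDivFree_carrier
  ae_isWeaklyDivFree := by
    filter_upwards [h₁.ae_isWeaklyDivFree, h₂.ae_isWeaklyDivFree, h₁.ae_memLp_two, h₂.ae_memLp_two]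
      with t hd₁ hd₂ hm₁ hm₂
    exact isWeaklyDivFree_sub₃ hd₁ hd₂ (hm₁.integrable one_le_two) (hm₂.integrable one_le_two)
  weak_eq Ψ hΨ hΨdiv := by
    have e₁ := h₁.weak_eq Ψ hΨ hΨdiv
    have e₂ := h₂.weak_eq Ψ hΨ hΨdiv
    have hI₁ := h₁.integrable_weakIntegrand hΨ
    have hI₂ := h₂.integrable_weakIntegrand hΨ
    have hpt : ∀ t x, ⟪w₁ t x - w₂ t x, FunctionSpaces.Torus.timeDeriv Ψ t x +
          FunctionSpaces.Torus.convect (b t) (Ψ t) x + viscAdj 𝔸 (Ψ t) x⟫_ℝ +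
        A * ⟪b t x, FunctionSpaces.Torus.convect (fun y => w₁ t y - w₂ t y) (Ψ t) x⟫_ℝ =
        (⟪w₁ t x, FunctionSpaces.Torus.timeDeriv Ψ t x +
            FunctionSpaces.Torus.convect (b t) (Ψ t) x + viscAdj 𝔸 (Ψ t) x⟫_ℝ +
          A * ⟪b t x, FunctionSpaces.Torus.convect (w₁ t) (Ψ t) x⟫_ℝ) -
        (⟪w₂ t x, FunctionSpaces.Torus.timeDeriv Ψ t x +
            FunctionSpaces.Torus.convect (b t) (Ψ t) x + viscAdj 𝔸 (Ψ t) x⟫_ℝ +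
          A * ⟪b t x, FunctionSpaces.Torus.convect (w₂ t) (Ψ t) x⟫_ℝ) := by
      intro t x
      simp only [FunctionSpaces.Torus.convect, map_sub, inner_sub_left, inner_sub_right]
      ring
    have hslice : ∀ᵐ t ∂(volume.restrict (Ioo 0 T)),
        ∫ x, (⟪w₁ t x - w₂ t x, FunctionSpaces.Torus.timeDeriv Ψ t x +
            FunctionSpaces.Torus.convect (b t) (Ψ t) x + viscAdj 𝔸 (Ψ t) x⟫_ℝ +
          A * ⟪b t x, FunctionSpaces.Torus.convect (fun y => w₁ t y - w₂ t y) (Ψ t) x⟫_ℝ) =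
        (∫ x, (⟪w₁ t x, FunctionSpaces.Torus.timeDeriv Ψ t x +
            FunctionSpaces.Torus.convect (b t) (Ψ t) x + viscAdj 𝔸 (Ψ t) x⟫_ℝ +
          A * ⟪b t x, FunctionSpaces.Torus.convect (w₁ t) (Ψ t) x⟫_ℝ)) -
        ∫ x, (⟪w₂ t x, FunctionSpaces.Torus.timeDeriv Ψ t x +
            FunctionSpaces.Torus.convect (b t) (Ψ t) x + viscAdj 𝔸 (Ψ t) x⟫_ℝ +
          A * ⟪b t x, FunctionSpaces.Torus.convect (w₂ t) (Ψ t) x⟫_ℝ) := by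
      filter_upwards [hI₁.prod_right_ae, hI₂.prod_right_ae] with t ht₁ ht₂
      rw [← integral_sub ht₁ ht₂]
      exact integral_congr_ae (Eventually.of_forall fun x => hpt t x)
    have key : (∫ t in Ioo 0 T, ∫ x, (⟪w₁ t x - w₂ t x, FunctionSpaces.Torus.timeDeriv Ψ t x +
            FunctionSpaces.Torus.convect (b t) (Ψ t) x + viscAdj 𝔸 (Ψ t) x⟫_ℝ +
          A * ⟪b t x, FunctionSpaces.Torus.convect (fun y => w₁ t y - w₂ t y) (Ψ t) x⟫_ℝ)) +
        ∫ x, ⟪(0 : UnitAddTorus d → EuclideanSpace ℝ d) x, Ψ 0 x⟫_ℝ = 0 := by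
      rw [integral_congr_ae hslice, integral_sub hI₁.integral_prod_left hI₂.integral_prod_left]
      simp only [Pi.zero_apply, inner_zero_left, integral_zero, add_zero]
      linarith
    exact key

/-- **Uniqueness of weak passive-vector solutions with a constant coercive viscosity tensor and
bounded carrier.** For a tensor with `NearIso 𝔸 lo hi`, `0 < lo`, any coupling `A` and a carrier
`b ∈ L^∞((0,T) × T^d)`, two weak solutions `w₁, w₂ ∈ L^∞_t L²_x` of
`∂ₜw + (b·∇)w + A (w·∇)b + ∇π = 𝓛_𝔸 w`, `∇·w = 0`, with the same datum coincide for a.e.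
`t ∈ (0,T)` (difference ↦ datum `0` by `sub_of_eq`, then `ae_eq_zero_of_memLp_top`).
[cite: Evans2010, §7.1.2 Thm. 2] [cite: Frisch1995Turbulence, §9.6.3 eq. (9.57) p. 233] -/
theorem ae_eq_of_memLp_top {lo hi : ℝ} (h𝔸 : NearIso 𝔸 lo hi) (hlo : 0 < lo)
    (h₁ : IsWeakTensorPassiveVectorOn A T 𝔸 b w₀ w₁) (h₂ : IsWeakTensorPassiveVectorOn A T 𝔸 b w₀ w₂)
    (hb : MemLp (FunctionSpaces.Torus.stLift b) ∞ (volume.restrict (Ioo 0 T ×ˢ univ))) :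
    ∀ᵐ t ∂(volume.restrict (Ioo 0 T)), w₁ t =ᵐ[volume] w₂ t := by
  filter_upwards [(sub_of_eq h₁ h₂).ae_eq_zero_of_memLp_top h𝔸 hlo hb] with t ht
  filter_upwards [ht] with x hx
  exact sub_eq_zero.1 hx

end IsWeakTensorPassiveVectorOn

end Uniqueness

end Torus

end Literature.Analysis.FluidPDE

end
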